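/-
Copyright (c) 2026 the pub-hodgecm-mathlib formalisation cell (harness21).  Prover seat hodgecm-mathlib-K2E4-p14 (g5), Track B ∕ K2-LIT, h413 =
`stmt-HodgeConjecture-24833`, line `K2_E1_TraceFormulaBeta`, campaign «EIS-RANK-ONE» rung R6f(ii); DEAL «MS-FIN-2» of the dealer K2E1-plan (g4) 2026-09-04T06:27:55Z (4)
(«discharge `hψL1 hi₅ habs habs'`»), census∕heads 06:3xZ.
-/
import Summits.HodgeConjecture.HodgeConjecture.Theorems.K2E1IntertwiningGrowthU3   -- ★ p857898 (this seat): `M(w₀)H^σ = c(σ)H^{2−σ}`, its finiteness, ED. 6, and the whole chain's closure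
import HarnessLib

/-!
# K2·E1 — `K2E1MaassSelbergCMThreePairings` (ED. 1, §1): HEIGHT-ONLY MAJORANTS FOR THE FOUR ABSOLUTE-CONVERGENCE INPUTS `hψL1`, `hi₅`, `habs`, `habs′`
# (campaign «EIS-RANK-ONE», rung R6f(ii), deal «MS-FIN-2» of the dealer K2E1-plan (g4) 2026-09-04T06:27:55Z: the `[0,∞]` Tonelli half of ★ (δ) p857604 at height-only weights, Tate at the cut-off)

Track B ∕ K2-LIT, crux h413 = `stmt-HodgeConjecture-24833`, route of record `HCCMUnconditional`; cell `hodgecm-mathlib`, squad K2, ENGINE E1.  Prover seat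
`hodgecm-mathlib-K2E4-p14` (g5); dealt by K2E1-plan (g4) 2026-09-04T06:27:55Z (census∕heads on the K2 bus 06:4xZ).  THEOREMS ONLY (no `def`, no `instance`, no notation, no
named-fact hypothesis, no `sorry`); lane `--supports stmt-HodgeConjecture-24833 --as helper` (count-neutral).  Closes no socket.  Generic quadratic `(F, E, c)`, `[E:F] = 2`, `c² = 1`, `c ≠ 1`.

THE MATHEMATICS [MoeglinWaldspurger1995, II.1.5, IV.2.1–IV.2.3; Garrett2018, §11.3].  Every one of the four surviving absolute-convergence inputs of ★ «CM-FINAL» ∕ ★ ED. 6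
(`hψL1`, `hi₅`, `habs`, `habs′`) is dominated, on the sub-tube `2 < Re z′ < Re z`, by `B(F)`-weighted integrals of HEIGHT-ONLY weights `Ψ′ = 𝟙_P(H)·H^σ` (census on the bus:
`hψL1 ↦ (Re z; ≤), (2−Re z; >)`, `hi₅, habs ↦ (2+Re z−Re z′; ≤), (4−Re z−Re z′; >)`, `habs′ ↦ (2+Re z′−Re z; >)`).  This edition lands the TOOL, §1:
**`exists_lintegral_weight_mul_indicator_borelHeight_rpow_eq_three`** — one `K′ < ∞` with `∫⁻ β·𝟙_P(H)·H^σ dν_G = K′·∫⁻_{𝓕_I} (‖x‖·‖x‖)⁻¹·𝟙_P(‖x‖)·‖x‖^σ dν_I` for every covering weight `β`,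
Borel `P`, real `σ` (★ (δ)'s `[0,∞]` half at a left-`N(𝔸)`∕`B(F)`-, right-`K_U`-invariant weight whose `K_U`-integral along the torus is `μ_K(K_U)·𝟙_P(‖d₀t‖)·‖d₀t‖^σ` — no `hΞ`-type input;
`K′ = K·μ_K(K_U)`, `K_U` compact ★), and its two finiteness corollaries **`lintegral_weight_mul_indicator_le_rpow_lt_top`** (`P = {≤ T}`, `σ > 2`, Tate ★) and
**`lintegral_weight_mul_indicator_lt_rpow_lt_top`** (`P = {> T}`, `σ < 2`, `T > 0`, mirror ★).  ED. 2 (§2 pointwise bounds of `ψ`, `∫_u|χ(w₀ug)|`, `∫_u|ψ(w₀⁻¹ug)|` via ★ [D8];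
§3 the four inputs in ED. 6's binder shapes; ED. 7 ∕ «CM-FINAL» ED. 2) follows by the append protocol.
HONEST LABEL: HC_CM is proved only modulo the 7 printed citations (2 remaining named inputs: hLiu418 = `stmt-HodgeConjecture-24832`, h413 = `stmt-HodgeConjecture-24833`) until rung 0
closes; this file asserts no named fact and closes no socket.
References: [MoeglinWaldspurger1995] II.1.5, IV.2.1–IV.2.3 · [Arthur1980TraceFormulaII] §4 · [Garrett2018] §2.8, §11.3 · [Rogawski1990] §2.2, §7.3.
-/

set_option autoImplicit false
-- the mandated namespace repeats the single-problem summit's segment (`HodgeConjecture.HodgeConjecture`)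
set_option linter.dupNamespace false

noncomputable section

open MeasureTheory Measure NumberField IsDedekindDomain Set MulAction Filter
open scoped ENNReal NNReal ComplexConjugate
open Literature.MeasureTheory.Group Literature.NumberTheory
open Literature.NumberTheory.Automorphic Literature.NumberTheory.Automorphic.UnitaryGroup AdelicGroupData
open Summit.HodgeConjecture.HodgeConjecture.Cruxes.H413.K2E1BorelEisensteinU
open Summit.HodgeConjecture.HodgeConjecture.Cruxes.H413.K2E1IdeleClassMellinWeighted
open Summit.HodgeConjecture.HodgeConjecture.Cruxes.H413.K2E1TorusHeightMellin
open Summit.HodgeConjecture.HodgeConjecture.Cruxes.H413.K2E1MaassSelbergBracketsThree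
open Summit.HodgeConjecture.HodgeConjecture.Cruxes.H413.K2E1BorelParabolicIntegralU2 (borelHeight_coe_eq_ideleNorm_diagUnit)
open Summit.HodgeConjecture.HodgeConjecture.Cruxes.H413.K2E1EisensteinPairingUnfoldedWeight
open Summit.HodgeConjecture.HodgeConjecture.Cruxes.H413.K2E1IntertwiningGrowthU3

namespace Summit.HodgeConjecture.HodgeConjecture.Cruxes.H413.K2E1MaassSelbergCMThreePairings

variable {F E : Type} [Field F] [NumberField F] [Field E] [NumberField E] [Algebra F E] {c : E ≃ₐ[F] E}
variable [MeasurableSpace (quasiSplit F E c 3).Adelic] [BorelSpace (quasiSplit F E c 3).Adelic]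
variable [MeasurableSpace (AdeleRing (𝓞 E) E)ˣ] [BorelSpace (AdeleRing (𝓞 E) E)ˣ]

/-! ## §1 Height-only majorants: `∫⁻ β·𝟙_P(H)·H^σ dν_G = K′·∫⁻_{𝓕_I} (‖x‖·‖x‖)⁻¹·𝟙_P(‖x‖)·‖x‖^σ dν_I`, finite at the two cut-offs -/

/-- **THE `[0,∞]` TONELLI IDENTITY FOR HEIGHT-ONLY WEIGHTS**: one `K′ < ∞` with `∫⁻ β(g)·𝟙_P(H g)·H(g)^σ dν_G = K′·∫⁻_{𝓕_I} (‖x‖·‖x‖)⁻¹·𝟙_P(‖x‖)·‖x‖^σ dν_I` for every covering weight `β`,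
Borel `P`, real `σ` — ★ (δ) p857604's `[0,∞]` half at `Ψ = 𝟙_P(H)·H^σ` (left-`N(𝔸)`∕`B(F)`-invariant, `K_U`-invariant: its `K_U`-integral along the torus is `μ_K(K_U)·𝟙_P(‖d₀t‖)·‖d₀t‖^σ`;
`K′ = K·μ_K(K_U)`, `K_U` compact ★). [cite: MoeglinWaldspurger1995, II.1.5] [cite: Garrett2018, §11.3] -/
theorem exists_lintegral_weight_mul_indicator_borelHeight_rpow_eq_three (h2 : Module.finrank F E = 2) (hc : c * c = 1) (hc1 : c ≠ 1)
    (νG : Measure (quasiSplit F E c 3).Adelic) [νG.IsHaarMeasure]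
    (μK : Measure ((standardMaximalCompactGL 3 E).comap (adelicVal F E c 3 ((StdForm.antidiagonal 3).over E)) : Subgroup (quasiSplit F E c 3).Adelic))
    [μK.IsHaarMeasure]
    (νI : Measure (AdeleRing (𝓞 E) E)ˣ) [νI.IsHaarMeasure]
    (hBK : ∀ g : (quasiSplit F E c 3).Adelic, ∃ b ∈ borelAdelic F E c 3, ∃ k : (quasiSplit F E c 3).Adelic,
      adelicVal F E c 3 ((StdForm.antidiagonal 3).over E) k ∈ standardMaximalCompactGL 3 E ∧ g = b * k)
    {𝓕 : Set (AdeleRing (𝓞 E) E)ˣ} (h𝓕 : IsIdeleClassDomain E 𝓕) :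
    ∃ K' : ℝ≥0∞, K' ≠ ∞ ∧
      ∀ β : (quasiSplit F E c 3).Adelic → ℝ≥0∞, IsCoveringWeight ((arithmeticBorel F E c 3).map (quasiSplit F E c 3).arithmeticSubgroup.subtype) β →
      ∀ P : Set ℝ≥0, MeasurableSet P → ∀ σ : ℝ,
        ∫⁻ g, β g * P.indicator (fun h : ℝ≥0 => ENNReal.ofReal ((h : ℝ) ^ σ)) (borelHeight g) ∂νG =
          K' * ∫⁻ x in 𝓕, (((IdeleClassGroup.ideleNorm E x * IdeleClassGroup.ideleNorm E x)⁻¹ : ℝ≥0) : ℝ≥0∞) *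
            P.indicator (fun h : ℝ≥0 => ENNReal.ofReal ((h : ℝ) ^ σ)) (IdeleClassGroup.ideleNorm E x) ∂νI := by
  obtain ⟨K, -, hKt, hδ, -⟩ := exists_integral_weight_smul_eq_mul_setIntegral_ideleClass_three h2 hc hc1 νG μK νI hBK h𝓕
  have hKc : IsCompact (((standardMaximalCompactGL 3 E).comap (adelicVal F E c 3 ((StdForm.antidiagonal 3).over E)) :
      Subgroup (quasiSplit F E c 3).Adelic) : Set (quasiSplit F E c 3).Adelic) := isCompact_comap_adelicVal_standardMaximalCompactGL
  haveI : CompactSpace ((standardMaximalCompactGL 3 E).comap (adelicVal F E c 3 ((StdForm.antidiagonal 3).over E)) : Subgroup (quasiSplit F E c 3).Adelic) :=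
    isCompact_iff_compactSpace.1 hKc
  haveI : IsFiniteMeasure μK := CompactSpace.isFiniteMeasure
  refine ⟨K * μK Set.univ, ENNReal.mul_ne_top hKt (measure_ne_top μK _), fun β hβ P hP σ => ?_⟩
  have hIm : Measurable fun x : (AdeleRing (𝓞 E) E)ˣ => IdeleClassGroup.ideleNorm E x := (continuous_ideleNorm_holds E).measurable
  have hwm : Measurable (P.indicator (fun h : ℝ≥0 => ENNReal.ofReal ((h : ℝ) ^ σ))) :=
    (ENNReal.measurable_ofReal.comp (measurable_coe_nnreal_real.pow_const σ)).indicator hP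
  -- the height-only weight, its invariances and its `K_U`-integral along the torus
  have hΨN : ∀ (n : unipotentInBorel F E c 3) (y : (quasiSplit F E c 3).Adelic),
      P.indicator (fun h : ℝ≥0 => ENNReal.ofReal ((h : ℝ) ^ σ)) (borelHeight (((n : borelAdelic F E c 3) : (quasiSplit F E c 3).Adelic) * y)) =
        P.indicator (fun h : ℝ≥0 => ENNReal.ofReal ((h : ℝ) ^ σ)) (borelHeight y) := fun n y => by
    rw [borelHeight_unipotent_mul ((mem_unipotentInBorel_iff _).1 n.2)]
  have hΨB : ∀ b ∈ arithmeticBorel F E c 3, ∀ y : (quasiSplit F E c 3).Adelic,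
      P.indicator (fun h : ℝ≥0 => ENNReal.ofReal ((h : ℝ) ^ σ)) (borelHeight ((b : (quasiSplit F E c 3).Adelic) * y)) =
        P.indicator (fun h : ℝ≥0 => ENNReal.ofReal ((h : ℝ) ^ σ)) (borelHeight y) := fun b hb y => by
    rw [borelHeight_arithmeticBorel_mul hb]
  have hΦK : ∀ k ∈ GaloisRepresentations.principalIdeles E, ∀ x : (AdeleRing (𝓞 E) E)ˣ,
      P.indicator (fun h : ℝ≥0 => ENNReal.ofReal ((h : ℝ) ^ σ)) (IdeleClassGroup.ideleNorm E (k * x)) * μK Set.univ =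
        P.indicator (fun h : ℝ≥0 => ENNReal.ofReal ((h : ℝ) ^ σ)) (IdeleClassGroup.ideleNorm E x) * μK Set.univ := fun k hk x => by
    rw [map_mul, ideleNorm_principal hk, one_mul]
  have hAvg : ∀ t : torusInBorel F E c 3,
      ∫⁻ k, P.indicator (fun h : ℝ≥0 => ENNReal.ofReal ((h : ℝ) ^ σ))
          (borelHeight (((t : borelAdelic F E c 3) : (quasiSplit F E c 3).Adelic) * (k : (quasiSplit F E c 3).Adelic))) ∂μK =
        P.indicator (fun h : ℝ≥0 => ENNReal.ofReal ((h : ℝ) ^ σ)) (IdeleClassGroup.ideleNorm E (diagUnit (t : borelAdelic F E c 3).2 0)) * μK Set.univ := fun t => by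
    simp_rw [borelHeight_mul_of_mem_comap_standardMaximalCompactGL (Subtype.prop _), borelHeight_coe_eq_ideleNorm_diagUnit]
    rw [lintegral_const]
  have h := hδ β hβ (fun y => P.indicator (fun h : ℝ≥0 => ENNReal.ofReal ((h : ℝ) ^ σ)) (borelHeight y)) (hwm.comp measurable_borelHeight) hΨN hΨB
    (fun x => P.indicator (fun h : ℝ≥0 => ENNReal.ofReal ((h : ℝ) ^ σ)) (IdeleClassGroup.ideleNorm E x) * μK Set.univ) ((hwm.comp hIm).mul_const _) hΦK hAvg
  rw [h, mul_assoc, ← lintegral_const_mul' _ _ (measure_ne_top μK _)]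
  congr 1
  refine lintegral_congr fun x => ?_
  ring


omit [MeasurableSpace (quasiSplit F E c 3).Adelic] [BorelSpace (quasiSplit F E c 3).Adelic] [MeasurableSpace (AdeleRing (𝓞 E) E)ˣ] [BorelSpace (AdeleRing (𝓞 E) E)ˣ] in
/-- The `δ_B⁻¹`-weighted idele integrand of a height-only weight: `(‖x‖·‖x‖)⁻¹ · 𝟙_P(‖x‖)·‖x‖^σ = 𝟙_{‖x‖ ∈ P}·‖x‖^{σ−2}` (★ (C1) `normSq_inv_mul_indicator_ofReal_rpow` at `C = 1`). [folklore] -/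
theorem normSq_inv_mul_indicator_rpow_apply (P : Set ℝ≥0) (σ : ℝ) (x : (AdeleRing (𝓞 E) E)ˣ) :
    (((IdeleClassGroup.ideleNorm E x * IdeleClassGroup.ideleNorm E x)⁻¹ : ℝ≥0) : ℝ≥0∞) * P.indicator (fun h : ℝ≥0 => ENNReal.ofReal ((h : ℝ) ^ σ)) (IdeleClassGroup.ideleNorm E x) =
      {x : (AdeleRing (𝓞 E) E)ˣ | IdeleClassGroup.ideleNorm E x ∈ P}.indicator (fun x => ENNReal.ofReal ((IdeleClassGroup.ideleNorm E x : ℝ) ^ (σ - 2))) x := by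
  have h : P.indicator (fun h : ℝ≥0 => ENNReal.ofReal ((h : ℝ) ^ σ)) (IdeleClassGroup.ideleNorm E x) =
      {x : (AdeleRing (𝓞 E) E)ˣ | IdeleClassGroup.ideleNorm E x ∈ P}.indicator (fun x => ENNReal.ofReal ((IdeleClassGroup.ideleNorm E x : ℝ) ^ σ * 1)) x := by
    by_cases hx : IdeleClassGroup.ideleNorm E x ∈ P
    · rw [Set.indicator_of_mem hx, Set.indicator_of_mem (show x ∈ {x : (AdeleRing (𝓞 E) E)ˣ | IdeleClassGroup.ideleNorm E x ∈ P} from hx), mul_one]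
    · rw [Set.indicator_of_notMem hx, Set.indicator_of_notMem (show x ∉ {x : (AdeleRing (𝓞 E) E)ˣ | IdeleClassGroup.ideleNorm E x ∈ P} from hx)]
  rw [h, normSq_inv_mul_indicator_ofReal_rpow P σ zero_le_one x, ENNReal.ofReal_one, one_mul]

/-- **FINITE BELOW THE CUT-OFF** (`σ > 2`): `∫⁻ β·𝟙_{H ≤ T}·H^σ dν_G < ∞` — §1's identity and Tate at the cut-off ★ `setLIntegral_indicator_ideleNorm_rpow_eq` (exponent `σ − 2 > 0`).
[cite: MoeglinWaldspurger1995, II.1.5] -/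
theorem lintegral_weight_mul_indicator_le_rpow_lt_top (h2 : Module.finrank F E = 2) (hc : c * c = 1) (hc1 : c ≠ 1)
    (νG : Measure (quasiSplit F E c 3).Adelic) [νG.IsHaarMeasure]
    (μK : Measure ((standardMaximalCompactGL 3 E).comap (adelicVal F E c 3 ((StdForm.antidiagonal 3).over E)) : Subgroup (quasiSplit F E c 3).Adelic))
    [μK.IsHaarMeasure]
    (νI : Measure (AdeleRing (𝓞 E) E)ˣ) [νI.IsHaarMeasure]
    (hBK : ∀ g : (quasiSplit F E c 3).Adelic, ∃ b ∈ borelAdelic F E c 3, ∃ k : (quasiSplit F E c 3).Adelic,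
      adelicVal F E c 3 ((StdForm.antidiagonal 3).over E) k ∈ standardMaximalCompactGL 3 E ∧ g = b * k)
    {𝓕I : Set (AdeleRing (𝓞 E) E)ˣ} (h𝓕I : IsIdeleClassDomain E 𝓕I)
    {β : (quasiSplit F E c 3).Adelic → ℝ≥0∞} (hβ : IsCoveringWeight ((arithmeticBorel F E c 3).map (quasiSplit F E c 3).arithmeticSubgroup.subtype) β)
    {σ : ℝ} (hσ : 2 < σ) (T : ℝ≥0) :
    ∫⁻ g, β g * (Set.Iic T).indicator (fun h : ℝ≥0 => ENNReal.ofReal ((h : ℝ) ^ σ)) (borelHeight g) ∂νG < ∞ := by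
  obtain ⟨K', hK', hId⟩ := exists_lintegral_weight_mul_indicator_borelHeight_rpow_eq_three h2 hc hc1 νG μK νI hBK h𝓕I
  rw [hId β hβ _ measurableSet_Iic σ]
  simp_rw [normSq_inv_mul_indicator_rpow_apply]
  rw [show {x : (AdeleRing (𝓞 E) E)ˣ | IdeleClassGroup.ideleNorm E x ∈ Set.Iic T} = {x : (AdeleRing (𝓞 E) E)ˣ | IdeleClassGroup.ideleNorm E x ≤ T} from rfl,
    K2E1BorelParabolicIntegralU3.setLIntegral_indicator_ideleNorm_rpow_eq E νI h𝓕I (by linarith) T]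
  exact ENNReal.mul_lt_top hK'.lt_top (ENNReal.mul_lt_top (idelicCovolume_lt_top νI) ENNReal.ofReal_lt_top)

/-- **FINITE ABOVE THE CUT-OFF** (`σ < 2`, `0 < T`): `∫⁻ β·𝟙_{T < H}·H^σ dν_G < ∞` — §1's identity and the mirror ★ `setLIntegral_indicator_lt_rpow_neg` (exponent `σ − 2 < 0`).
[cite: MoeglinWaldspurger1995, II.1.5] -/
theorem lintegral_weight_mul_indicator_lt_rpow_lt_top (h2 : Module.finrank F E = 2) (hc : c * c = 1) (hc1 : c ≠ 1)
    (νG : Measure (quasiSplit F E c 3).Adelic) [νG.IsHaarMeasure]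
    (μK : Measure ((standardMaximalCompactGL 3 E).comap (adelicVal F E c 3 ((StdForm.antidiagonal 3).over E)) : Subgroup (quasiSplit F E c 3).Adelic))
    [μK.IsHaarMeasure]
    (νI : Measure (AdeleRing (𝓞 E) E)ˣ) [νI.IsHaarMeasure]
    (hBK : ∀ g : (quasiSplit F E c 3).Adelic, ∃ b ∈ borelAdelic F E c 3, ∃ k : (quasiSplit F E c 3).Adelic,
      adelicVal F E c 3 ((StdForm.antidiagonal 3).over E) k ∈ standardMaximalCompactGL 3 E ∧ g = b * k)
    {𝓕I : Set (AdeleRing (𝓞 E) E)ˣ} (h𝓕I : IsIdeleClassDomain E 𝓕I)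
    {β : (quasiSplit F E c 3).Adelic → ℝ≥0∞} (hβ : IsCoveringWeight ((arithmeticBorel F E c 3).map (quasiSplit F E c 3).arithmeticSubgroup.subtype) β)
    {σ : ℝ} (hσ : σ < 2) {T : ℝ≥0} (hT : 0 < T) :
    ∫⁻ g, β g * (Set.Ioi T).indicator (fun h : ℝ≥0 => ENNReal.ofReal ((h : ℝ) ^ σ)) (borelHeight g) ∂νG < ∞ := by
  obtain ⟨K', hK', hId⟩ := exists_lintegral_weight_mul_indicator_borelHeight_rpow_eq_three h2 hc hc1 νG μK νI hBK h𝓕I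
  rw [hId β hβ _ measurableSet_Ioi σ]
  simp_rw [normSq_inv_mul_indicator_rpow_apply]
  rw [(setOf_ideleNorm_mem_Iic_eq (E := E) T).2, show σ - 2 = -(2 - σ) by ring,
    setLIntegral_indicator_lt_rpow_neg νI (h𝓕I.isFundamentalDomain νI) (by linarith) (NNReal.coe_pos.2 hT)]
  exact ENNReal.mul_lt_top hK'.lt_top (ENNReal.mul_lt_top (idelicCovolume_lt_top νI) ENNReal.ofReal_lt_top)

/-! ## §2 (ED. 2) Pointwise: `|ψ|`, `∫_u |χ(w₀ u g)| dν`, `∫_u |ψ(w₀⁻¹ u g)| dν` are dominated by height-only weights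
(ED. 2 of the dealer K2E1-plan (g4) 2026-09-04T06:36:29Z (6), prover seat `hodgecm-mathlib-K2E4-p14` (g6); `ψ = 𝟙_{H≤T}·f_z − 𝟙_{H>T}·(α_t·H^{2−z})` and
`χ = 𝟙_{H>T}·(f′_{z′} + α_t′·H^{2−z′})` for ANY bounded coefficients `α_t`, `α_t′` — at `α_t = φ̃ := (M(w₀) f_z)·H^{z−2}` these are ★ ED. 6's `ψ`, `χ`, and `‖φ̃‖ ≤ C_φ·c(Re z)` is ★ [D8] §5) -/

section Pointwise

open Summit.HodgeConjecture.HodgeConjecture.Cruxes.H413.K2E1MaassSelbergCMThreeConstantTerms (norm_indicator_lt_add_flatSectionU_le)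
open Summit.HodgeConjecture.HodgeConjecture.Cruxes.H413.K2E1MaassSelbergCMThreeIntertwined (measurable_intertwinedCoeff)
open Summit.HodgeConjecture.HodgeConjecture.Cruxes.H413.K2E1BorelHeightWeylUnipotent (not_lt_borelHeight_weylLongU_unipotent_mul)

omit [MeasurableSpace (quasiSplit F E c 3).Adelic] [BorelSpace (quasiSplit F E c 3).Adelic] [MeasurableSpace (AdeleRing (𝓞 E) E)ˣ] [BorelSpace (AdeleRing (𝓞 E) E)ˣ] in
/-- Height powers merge under a cut-off, in `[0,∞]`: `H(g)^a · (𝟙_P(H g)·H(g)^b) = 𝟙_P(H g)·H(g)^{a+b}` (`H(g) > 0` ★ `borelHeight_pos`). [folklore] -/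
theorem ofReal_rpow_mul_indicator_rpow_borelHeight (P : Set ℝ≥0) (a b : ℝ) (g : (quasiSplit F E c 3).Adelic) :
    ENNReal.ofReal ((borelHeight g : ℝ) ^ a) * P.indicator (fun h : ℝ≥0 => ENNReal.ofReal ((h : ℝ) ^ b)) (borelHeight g) =
      P.indicator (fun h : ℝ≥0 => ENNReal.ofReal ((h : ℝ) ^ (a + b))) (borelHeight g) := by
  have hpos : (0 : ℝ) < (borelHeight g : ℝ) := by exact_mod_cast borelHeight_pos g
  by_cases hP : borelHeight g ∈ P
  · rw [indicator_of_mem hP, indicator_of_mem hP, ← ENNReal.ofReal_mul (Real.rpow_nonneg hpos.le _), Real.rpow_add hpos]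
  · rw [indicator_of_notMem hP, indicator_of_notMem hP, mul_zero]

omit [MeasurableSpace (quasiSplit F E c 3).Adelic] [BorelSpace (quasiSplit F E c 3).Adelic] [MeasurableSpace (AdeleRing (𝓞 E) E)ˣ] [BorelSpace (AdeleRing (𝓞 E) E)ˣ] in
/-- **`|ψ(g)| ≤ C_φ·𝟙_{H≤T}(g)·H(g)^{Re z} + C_t·𝟙_{H>T}(g)·H(g)^{2−Re z}`** for `ψ = 𝟙_{H≤T}·f_z − 𝟙_{H>T}·(α_t·H^{2−z})`, `‖φ‖ ≤ C_φ`, `‖α_t‖ ≤ C_t` (at `α_t = φ̃`: `C_t = C_φ·c(Re z)`,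
★ [D8] `norm_intertwinedCoeff_le`). [cite: MoeglinWaldspurger1995, II.1.5] -/
theorem enorm_psi_le {φ αt : (quasiSplit F E c 3).Adelic → ℂ} {Cφ Ct : ℝ} (hφC : ∀ x, ‖φ x‖ ≤ Cφ) (hCt : ∀ x, ‖αt x‖ ≤ Ct) (z : ℂ) (T : ℝ≥0) (g : (quasiSplit F E c 3).Adelic) :
    ‖{y : (quasiSplit F E c 3).Adelic | borelHeight y ≤ T}.indicator (flatSectionU φ z) g - {y : (quasiSplit F E c 3).Adelic | T < borelHeight y}.indicator (flatSectionU αt (2 - z)) g‖ₑ ≤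
      ENNReal.ofReal Cφ * (Set.Iic T).indicator (fun h : ℝ≥0 => ENNReal.ofReal ((h : ℝ) ^ z.re)) (borelHeight g) +
        ENNReal.ofReal Ct * (Set.Ioi T).indicator (fun h : ℝ≥0 => ENNReal.ofReal ((h : ℝ) ^ (2 - z.re))) (borelHeight g) := by
  have hpos : (0 : ℝ) < (borelHeight g : ℝ) := by exact_mod_cast borelHeight_pos g
  by_cases hg : borelHeight g ≤ T
  · have hng : ¬ T < borelHeight g := not_lt.2 hg
    rw [indicator_of_mem (show g ∈ {y : (quasiSplit F E c 3).Adelic | borelHeight y ≤ T} from hg),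
      indicator_of_notMem (show g ∉ {y : (quasiSplit F E c 3).Adelic | T < borelHeight y} from hng), sub_zero,
      indicator_of_mem (show borelHeight g ∈ Set.Iic T from hg), indicator_of_notMem (show borelHeight g ∉ Set.Ioi T from hng), mul_zero, add_zero,
      ← ofReal_norm, flatSectionU_apply, norm_mul, Complex.norm_cpow_eq_rpow_re_of_pos hpos, ← ENNReal.ofReal_mul ((norm_nonneg _).trans (hφC g))]
    exact ENNReal.ofReal_le_ofReal (mul_le_mul_of_nonneg_right (hφC g) (Real.rpow_nonneg hpos.le _))
  · have hgt : T < borelHeight g := not_le.1 hg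
    rw [indicator_of_notMem (show g ∉ {y : (quasiSplit F E c 3).Adelic | borelHeight y ≤ T} from hg),
      indicator_of_mem (show g ∈ {y : (quasiSplit F E c 3).Adelic | T < borelHeight y} from hgt), zero_sub, enorm_neg,
      indicator_of_notMem (show borelHeight g ∉ Set.Iic T from hg), indicator_of_mem (show borelHeight g ∈ Set.Ioi T from hgt), mul_zero, zero_add,
      ← ofReal_norm, flatSectionU_apply, norm_mul, Complex.norm_cpow_eq_rpow_re_of_pos hpos, Complex.sub_re, show (2 : ℂ).re = 2 by norm_num,
      ← ENNReal.ofReal_mul ((norm_nonneg _).trans (hCt g))]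
    exact ENNReal.ofReal_le_ofReal (mul_le_mul_of_nonneg_right (hCt g) (Real.rpow_nonneg hpos.le _))

omit [MeasurableSpace (quasiSplit F E c 3).Adelic] [BorelSpace (quasiSplit F E c 3).Adelic] [MeasurableSpace (AdeleRing (𝓞 E) E)ˣ] [BorelSpace (AdeleRing (𝓞 E) E)ˣ] in
/-- **`|χ(y)| ≤ (C_φ′ + C_t′·T^{2−2Re z′})·H(y)^{Re z′}`** in `[0,∞]` for the cut-off `χ = 𝟙_{H>T}·(f′_{z′} + α_t′·H^{2−z′})` (`0 < T`, `1 ≤ Re z′`; ★ ED. 4 `norm_indicator_lt_add_flatSectionU_le`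
with `‖1·H^{z′}(y)‖ = H(y)^{Re z′}`). [cite: MoeglinWaldspurger1995, II.1.5] -/
theorem enorm_chi_le {φ' αt' : (quasiSplit F E c 3).Adelic → ℂ} {Cφ' Ct' : ℝ} (hφ'C : ∀ x, ‖φ' x‖ ≤ Cφ') (hCt' : ∀ x, ‖αt' x‖ ≤ Ct') {T : ℝ≥0} (hT0 : 0 < T)
    {z' : ℂ} (hz' : 1 ≤ z'.re) (y : (quasiSplit F E c 3).Adelic) :
    ‖{y : (quasiSplit F E c 3).Adelic | T < borelHeight y}.indicator (flatSectionU φ' z' + flatSectionU αt' (2 - z')) y‖ₑ ≤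
      ENNReal.ofReal (Cφ' + Ct' * (T : ℝ) ^ (2 - 2 * z'.re)) * ENNReal.ofReal ((borelHeight y : ℝ) ^ z'.re) := by
  have hpos : (0 : ℝ) < (borelHeight y : ℝ) := by exact_mod_cast borelHeight_pos y
  have hA : 0 ≤ Cφ' + Ct' * (T : ℝ) ^ (2 - 2 * z'.re) :=
    add_nonneg ((norm_nonneg _).trans (hφ'C 1)) (mul_nonneg ((norm_nonneg _).trans (hCt' 1)) (Real.rpow_nonneg (NNReal.coe_nonneg T) _))
  have h := norm_indicator_lt_add_flatSectionU_le hφ'C hCt' hT0 hz' y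
  rw [flatSectionU_apply, one_mul, Complex.norm_cpow_eq_rpow_re_of_pos hpos] at h
  rw [← ofReal_norm, ← ENNReal.ofReal_mul hA]
  exact ENNReal.ofReal_le_ofReal h

omit [MeasurableSpace (AdeleRing (𝓞 E) E)ˣ] [BorelSpace (AdeleRing (𝓞 E) E)ˣ] in
/-- **`g ↦ ∫_{N(𝔸)} h(w₀ u g) dν(u)` IS BOREL** for Borel `h` (★ ED. 5 `measurable_intertwinedCoeff` at the flat section `h·H^0` and the outer factor `H^0`: the parametric Bochner integral of a
jointly Borel integrand, `N(𝔸)` second countable, `ν` s-finite). [cite: MoeglinWaldspurger1995, II.1.6] -/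
theorem measurable_integral_weylLongU_mul (ν : Measure ↥(adelicUnipotent F E c 3)) [ν.IsHaarMeasure] {h : (quasiSplit F E c 3).Adelic → ℂ} (hh : Measurable h) :
    Measurable fun g : (quasiSplit F E c 3).Adelic => ∫ u : ↥(adelicUnipotent F E c 3),
      h ((quasiSplit F E c 3).toAdelic (weylLongU (c : E →+* E) (rfl : (StdForm.antidiagonal 3).over E = (StdForm.antidiagonal 3).over E)) * ((u : (quasiSplit F E c 3).Adelic) * g)) ∂ν := by
  have key := measurable_intertwinedCoeff ν hh 0 0
  simp only [flatSectionU_apply, Complex.cpow_zero, mul_one] at key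
  exact key

omit [MeasurableSpace (AdeleRing (𝓞 E) E)ˣ] [BorelSpace (AdeleRing (𝓞 E) E)ˣ] in
/-- **`∫_u ‖χ(w₀ u g)‖ dν(u) ≤ (C_φ′ + C_t′·T^{2−2Re z′}) · c(Re z′) · H(g)^{2−Re z′}`** in `[0,∞]`, `c(σ) = ∫_{N(𝔸)} H(w₀ v)^σ dν`: pointwise `|χ| ≤ (…)·H^{Re z′}` (`enorm_chi_le`), the
integrability of `u ↦ H(w₀ u g)^{Re z′}` from the Godement finiteness of `H^{z′}` at `g` (★ [D8] §4) and the standard intertwining integral ★ [D8] §3 `∫ H(w₀ u g)^σ dν = c(σ)·H(g)^{2−σ}`.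
[cite: MoeglinWaldspurger1995, II.1.6] [cite: Garrett2018, §2.8] -/
theorem lintegral_enorm_chi_weylLongU_mul_le (hc : c * c = 1) (hc1 : c ≠ 1) (ν : Measure ↥(adelicUnipotent F E c 3)) [ν.IsHaarMeasure] [ν.IsInvInvariant]
    (hBK : ∀ g : (quasiSplit F E c 3).Adelic, ∃ b ∈ borelAdelic F E c 3, ∃ k : (quasiSplit F E c 3).Adelic, adelicVal F E c 3 ((StdForm.antidiagonal 3).over E) k ∈ standardMaximalCompactGL 3 E ∧ g = b * k)
    {𝓕 : Set ↥(adelicUnipotent F E c 3)} (h𝓕N : IsFundamentalDomain ↥(rationalUnipotent F E c 3) 𝓕 ν)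
    {φ' αt' : (quasiSplit F E c 3).Adelic → ℂ} {Cφ' Ct' : ℝ} (hφ'C : ∀ x, ‖φ' x‖ ≤ Cφ') (hCt' : ∀ x, ‖αt' x‖ ≤ Ct') {T : ℝ≥0} (hT0 : 0 < T) {z' : ℂ} (hz' : 1 ≤ z'.re)
    (g : (quasiSplit F E c 3).Adelic)
    (hfin : ∫⁻ u in 𝓕, (∑' q : (quasiSplit F E c 3).quotientSubgroup ⧸ (borelAdelic F E c 3).subgroupOf (quasiSplit F E c 3).quotientSubgroup,
        ‖flatSectionU (fun _ : (quasiSplit F E c 3).Adelic => (1 : ℂ)) z' ((((q.out : (quasiSplit F E c 3).quotientSubgroup) : (quasiSplit F E c 3).Adelic))⁻¹ * (u : (quasiSplit F E c 3).Adelic) * g)‖ₑ) ∂ν < ∞) :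
    ∫⁻ u : ↥(adelicUnipotent F E c 3), ‖{y : (quasiSplit F E c 3).Adelic | T < borelHeight y}.indicator (flatSectionU φ' z' + flatSectionU αt' (2 - z'))
        ((quasiSplit F E c 3).toAdelic (weylLongU (c : E →+* E) (rfl : (StdForm.antidiagonal 3).over E = (StdForm.antidiagonal 3).over E)) * ((u : (quasiSplit F E c 3).Adelic) * g))‖ₑ ∂ν ≤
      ENNReal.ofReal (Cφ' + Ct' * (T : ℝ) ^ (2 - 2 * z'.re)) *
        ENNReal.ofReal (∫ v : ↥(adelicUnipotent F E c 3), (borelHeight ((quasiSplit F E c 3).toAdelic (weylLongU (c : E →+* E) (rfl : (StdForm.antidiagonal 3).over E = (StdForm.antidiagonal 3).over E)) * (v : (quasiSplit F E c 3).Adelic)) : ℝ) ^ z'.re ∂ν) *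
          ENNReal.ofReal ((borelHeight g : ℝ) ^ (2 - z'.re)) := by
  have hc0 : 0 ≤ ∫ v : ↥(adelicUnipotent F E c 3), (borelHeight ((quasiSplit F E c 3).toAdelic (weylLongU (c : E →+* E) (rfl : (StdForm.antidiagonal 3).over E = (StdForm.antidiagonal 3).over E)) * (v : (quasiSplit F E c 3).Adelic)) : ℝ) ^ z'.re ∂ν :=
    integral_nonneg fun v => Real.rpow_nonneg (NNReal.coe_nonneg _) _
  have hA : 0 ≤ Cφ' + Ct' * (T : ℝ) ^ (2 - 2 * z'.re) :=
    add_nonneg ((norm_nonneg _).trans (hφ'C 1)) (mul_nonneg ((norm_nonneg _).trans (hCt' 1)) (Real.rpow_nonneg (NNReal.coe_nonneg T) _))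
  have hI := integrable_borelHeight_weylLongU_mul_rpow ν h𝓕N z' g hfin
  calc ∫⁻ u : ↥(adelicUnipotent F E c 3), ‖{y : (quasiSplit F E c 3).Adelic | T < borelHeight y}.indicator (flatSectionU φ' z' + flatSectionU αt' (2 - z'))
          ((quasiSplit F E c 3).toAdelic (weylLongU (c : E →+* E) (rfl : (StdForm.antidiagonal 3).over E = (StdForm.antidiagonal 3).over E)) * ((u : (quasiSplit F E c 3).Adelic) * g))‖ₑ ∂ν
      ≤ ∫⁻ u : ↥(adelicUnipotent F E c 3), ENNReal.ofReal (Cφ' + Ct' * (T : ℝ) ^ (2 - 2 * z'.re)) *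
          ENNReal.ofReal ((borelHeight ((quasiSplit F E c 3).toAdelic (weylLongU (c : E →+* E) (rfl : (StdForm.antidiagonal 3).over E = (StdForm.antidiagonal 3).over E)) * ((u : (quasiSplit F E c 3).Adelic) * g)) : ℝ) ^ z'.re) ∂ν :=
        lintegral_mono fun u => enorm_chi_le hφ'C hCt' hT0 hz' _
    _ = ENNReal.ofReal (Cφ' + Ct' * (T : ℝ) ^ (2 - 2 * z'.re)) *
          ENNReal.ofReal (∫ u : ↥(adelicUnipotent F E c 3), (borelHeight ((quasiSplit F E c 3).toAdelic (weylLongU (c : E →+* E) (rfl : (StdForm.antidiagonal 3).over E = (StdForm.antidiagonal 3).over E)) * ((u : (quasiSplit F E c 3).Adelic) * g)) : ℝ) ^ z'.re ∂ν) := by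
        rw [lintegral_const_mul' _ _ ENNReal.ofReal_ne_top, ofReal_integral_eq_lintegral_ofReal hI (Eventually.of_forall fun u => Real.rpow_nonneg (NNReal.coe_nonneg _) _)]
    _ = _ := by rw [integral_borelHeight_weylLongU_mul_rpow_eq hc hc1 ν hBK z'.re g, ENNReal.ofReal_mul hc0, mul_assoc]

omit [MeasurableSpace (AdeleRing (𝓞 E) E)ˣ] [BorelSpace (AdeleRing (𝓞 E) E)ˣ] in
/-- **`∫_u ‖ψ(w₀⁻¹ u g)‖ dν(u) ≤ C_φ · c(Re z) · H(g)^{2−Re z}` ON `{H(g) > T}`** (`T ≥ 1`): there every `w₀ u g` is low (★ R6a `not_lt_borelHeight_weylLongU_unipotent_mul`, `w₀⁻¹ = w₀` ★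
`weylLongU_mul_weylLongU`), so `ψ(w₀⁻¹ u g) = f_z(w₀ u g)`, `|f_z| ≤ C_φ·H^{Re z}`, and ★ [D8] §3∕§4 evaluate∕control `∫ H(w₀ u g)^{Re z} dν = c(Re z)·H(g)^{2−Re z}`.
[cite: MoeglinWaldspurger1995, II.1.6–II.1.7] [cite: Garrett2018, §2.8] -/
theorem lintegral_enorm_psi_weylLongU_inv_mul_le (hc : c * c = 1) (hc1 : c ≠ 1) (ν : Measure ↥(adelicUnipotent F E c 3)) [ν.IsHaarMeasure] [ν.IsInvInvariant]
    (hBK : ∀ g : (quasiSplit F E c 3).Adelic, ∃ b ∈ borelAdelic F E c 3, ∃ k : (quasiSplit F E c 3).Adelic, adelicVal F E c 3 ((StdForm.antidiagonal 3).over E) k ∈ standardMaximalCompactGL 3 E ∧ g = b * k)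
    {𝓕 : Set ↥(adelicUnipotent F E c 3)} (h𝓕N : IsFundamentalDomain ↥(rationalUnipotent F E c 3) 𝓕 ν)
    {φ : (quasiSplit F E c 3).Adelic → ℂ} (αt : (quasiSplit F E c 3).Adelic → ℂ) {Cφ : ℝ} (hφC : ∀ x, ‖φ x‖ ≤ Cφ) (z : ℂ) {T : ℝ≥0} (hT : 1 ≤ T)
    {g : (quasiSplit F E c 3).Adelic} (hg : T < borelHeight g)
    (hfin : ∫⁻ u in 𝓕, (∑' q : (quasiSplit F E c 3).quotientSubgroup ⧸ (borelAdelic F E c 3).subgroupOf (quasiSplit F E c 3).quotientSubgroup,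
        ‖flatSectionU (fun _ : (quasiSplit F E c 3).Adelic => (1 : ℂ)) z ((((q.out : (quasiSplit F E c 3).quotientSubgroup) : (quasiSplit F E c 3).Adelic))⁻¹ * (u : (quasiSplit F E c 3).Adelic) * g)‖ₑ) ∂ν < ∞) :
    ∫⁻ u : ↥(adelicUnipotent F E c 3), ‖{y : (quasiSplit F E c 3).Adelic | borelHeight y ≤ T}.indicator (flatSectionU φ z) (((quasiSplit F E c 3).toAdelic (weylLongU (c : E →+* E) (rfl : (StdForm.antidiagonal 3).over E = (StdForm.antidiagonal 3).over E)))⁻¹ * ((u : (quasiSplit F E c 3).Adelic) * g)) - {y : (quasiSplit F E c 3).Adelic | T < borelHeight y}.indicator (flatSectionU αt (2 - z)) (((quasiSplit F E c 3).toAdelic (weylLongU (c : E →+* E) (rfl : (StdForm.antidiagonal 3).over E = (StdForm.antidiagonal 3).over E)))⁻¹ * ((u : (quasiSplit F E c 3).Adelic) * g))‖ₑ ∂ν ≤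
      ENNReal.ofReal Cφ *
        ENNReal.ofReal (∫ v : ↥(adelicUnipotent F E c 3), (borelHeight ((quasiSplit F E c 3).toAdelic (weylLongU (c : E →+* E) (rfl : (StdForm.antidiagonal 3).over E = (StdForm.antidiagonal 3).over E)) * (v : (quasiSplit F E c 3).Adelic)) : ℝ) ^ z.re ∂ν) *
          ENNReal.ofReal ((borelHeight g : ℝ) ^ (2 - z.re)) := by
  have hCφ : 0 ≤ Cφ := (norm_nonneg _).trans (hφC 1)
  have hc0 : 0 ≤ ∫ v : ↥(adelicUnipotent F E c 3), (borelHeight ((quasiSplit F E c 3).toAdelic (weylLongU (c : E →+* E) (rfl : (StdForm.antidiagonal 3).over E = (StdForm.antidiagonal 3).over E)) * (v : (quasiSplit F E c 3).Adelic)) : ℝ) ^ z.re ∂ν :=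
    integral_nonneg fun v => Real.rpow_nonneg (NNReal.coe_nonneg _) _
  have hI := integrable_borelHeight_weylLongU_mul_rpow ν h𝓕N z g hfin
  -- `w₀⁻¹ = w₀`
  have hW : ((quasiSplit F E c 3).toAdelic (weylLongU (c : E →+* E) (rfl : (StdForm.antidiagonal 3).over E = (StdForm.antidiagonal 3).over E)))⁻¹ =
      (quasiSplit F E c 3).toAdelic (weylLongU (c : E →+* E) (rfl : (StdForm.antidiagonal 3).over E = (StdForm.antidiagonal 3).over E)) := by
    rw [← map_inv]
    exact congrArg _ (inv_eq_of_mul_eq_one_right (weylLongU_mul_weylLongU (c : E →+* E) rfl))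
  -- on `{H(g) > T}` every `w₀ u g` is low: `ψ(w₀ u g) = f_z(w₀ u g)`, `|f_z| ≤ C_φ H^{Re z}`
  have hpt : ∀ u : ↥(adelicUnipotent F E c 3), ‖{y : (quasiSplit F E c 3).Adelic | borelHeight y ≤ T}.indicator (flatSectionU φ z) (((quasiSplit F E c 3).toAdelic (weylLongU (c : E →+* E) (rfl : (StdForm.antidiagonal 3).over E = (StdForm.antidiagonal 3).over E)))⁻¹ * ((u : (quasiSplit F E c 3).Adelic) * g)) - {y : (quasiSplit F E c 3).Adelic | T < borelHeight y}.indicator (flatSectionU αt (2 - z)) (((quasiSplit F E c 3).toAdelic (weylLongU (c : E →+* E) (rfl : (StdForm.antidiagonal 3).over E = (StdForm.antidiagonal 3).over E)))⁻¹ * ((u : (quasiSplit F E c 3).Adelic) * g))‖ₑ ≤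
      ENNReal.ofReal Cφ * ENNReal.ofReal ((borelHeight ((quasiSplit F E c 3).toAdelic (weylLongU (c : E →+* E) (rfl : (StdForm.antidiagonal 3).over E = (StdForm.antidiagonal 3).over E)) * ((u : (quasiSplit F E c 3).Adelic) * g)) : ℝ) ^ z.re) := by
    intro u
    have hnot := not_lt_borelHeight_weylLongU_unipotent_mul u.2 hT hg
    rw [mul_assoc] at hnot
    have hp : (0 : ℝ) < (borelHeight ((quasiSplit F E c 3).toAdelic (weylLongU (c : E →+* E) (rfl : (StdForm.antidiagonal 3).over E = (StdForm.antidiagonal 3).over E)) * ((u : (quasiSplit F E c 3).Adelic) * g)) : ℝ) := by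
      exact_mod_cast borelHeight_pos _
    rw [hW, indicator_of_mem (show (quasiSplit F E c 3).toAdelic (weylLongU (c : E →+* E) (rfl : (StdForm.antidiagonal 3).over E = (StdForm.antidiagonal 3).over E)) * ((u : (quasiSplit F E c 3).Adelic) * g) ∈ {y : (quasiSplit F E c 3).Adelic | borelHeight y ≤ T} from not_lt.1 hnot),
      indicator_of_notMem (show (quasiSplit F E c 3).toAdelic (weylLongU (c : E →+* E) (rfl : (StdForm.antidiagonal 3).over E = (StdForm.antidiagonal 3).over E)) * ((u : (quasiSplit F E c 3).Adelic) * g) ∉ {y : (quasiSplit F E c 3).Adelic | T < borelHeight y} from hnot),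
      sub_zero, ← ofReal_norm, flatSectionU_apply, norm_mul, Complex.norm_cpow_eq_rpow_re_of_pos hp, ← ENNReal.ofReal_mul hCφ]
    exact ENNReal.ofReal_le_ofReal (mul_le_mul_of_nonneg_right (hφC _) (Real.rpow_nonneg hp.le _))
  refine (lintegral_mono hpt).trans (le_of_eq ?_)
  rw [lintegral_const_mul' _ _ ENNReal.ofReal_ne_top, ← ofReal_integral_eq_lintegral_ofReal hI (Eventually.of_forall fun u => Real.rpow_nonneg (NNReal.coe_nonneg _) _),
    integral_borelHeight_weylLongU_mul_rpow_eq hc hc1 ν hBK z.re g, ENNReal.ofReal_mul hc0, mul_assoc]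

end Pointwise

end Summit.HodgeConjecture.HodgeConjecture.Cruxes.H413.K2E1MaassSelbergCMThreePairings

end
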